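import Mathlib.Analysis.Calculus.ParametricIntegral
import Mathlib.Analysis.SpecialFunctions.Trigonometric.InverseDeriv
import Mathlib.MeasureTheory.Measure.Lebesgue.Integral
import Mathlib.Analysis.SpecialFunctions.Gaussian.GaussianIntegral
import Literature.Analysis.FluidPDE.SawtoothCascadeResponseVorticity
import HarnessLib

/-!
# Curvature of the rounded sawtooth: `|S_δ″| ≤ 2/(δ√(2π))`, hence `|U_j″| ≤ 2√(2π) · N_j/δ_j`, and the
# response-vorticity bounds of the cascade with the explicit curvature cap

Proofs-layer sequel of `SawtoothCascade.lean` / `SawtoothCascadeSmooth.lean` /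
`SawtoothCascadeResponseVorticity.lean` (cell `ad-ideate`, route SawtoothPulseCascade; theorems only, no
definitions, no named facts). The rounded sawtooth is the Gaussian mollification
`S_δ = tri ⋆ g_δ` of the triangle wave `tri = arcsin ∘ sin` (slope `±1`, corners at `π/2 + πℤ`),
`g_δ(y) = e^{−y²/2δ²}/(δ√(2π))`. Differentiating the convolution once on the Lipschitz factor and once
on the Gaussian (Folland 1999, Prop. 8.10: `∂(f ⋆ g) = (∂f) ⋆ g = f ⋆ ∂g`; Thm. 2.27 for the
differentiation under the integral sign),

`S_δ′(θ) = ∫ tri′(θ − y) g_δ(y) dy = ∫ tri′(s) g_δ(θ − s) ds`,  `S_δ″(θ) = ∫ tri′(s) g_δ′(θ − s) ds`,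

and since `|tri′| ≤ 1` a.e. and `∫|g_δ′| = ∫ |u| g_δ(u) du/δ² = 2/(δ√(2π))`:

**`|S_δ″(θ)| ≤ 2/(δ√(2π))`** for all `θ` (`SawtoothCascade.abs_deriv_deriv_roundedSaw_le`), i.e. the
curvature of the rounded zig-zag is at most `2 g_δ(0)` — attained asymptotically at the corners, where
`S_δ″ ≈ ±2 g_δ(· − corner)`. For the cascade profile `U_j(y) = S_{δ_j}(2πN_j y)/(2πN_j)` this gives
**`|U_j″| ≤ 2√(2π) · N_j/δ_j`** (`CascadeParams.abs_deriv_deriv_U_le`): the curvature cap `K_j` of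
`SawtoothCascadeResponseVorticity` IS the census's "honest localisation scale `N_j/δ_j`"
(lead CENSUS-ApproxSol58-g3 §1) up to the factor `2√(2π) ≈ 5.01`. Plugged into the response-vorticity
bounds of that file (`CascadeParams.abs_responseVorticity_le_of_mem_H₀/…`):

* `CascadeParams.abs_responseVorticity_le_of_mem_H₁/_V₁` — for every classical divergence-free solution
  of the Navier–Stokes equations linearised at the cascade on a window inside one half-slot, `ν ≥ 0`:
  `|ω_w(t, x)| ≤ sup|ω_w(a, ·)| + 2√(2π)(N_j/δ_j) ∫ₐᵗ rate_j(τ) sup|w_cross(τ, ·)| dτ`;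
* `CascadeParams.sqrt_integral_responseVorticity_sq_le_of_mem_H₁/_V₁` —
  `‖ω_w(t)‖₂ ≤ ‖ω_w(a)‖₂ + 2√(2π)(N_j/δ_j) ∫ₐᵗ rate_j(τ) ‖w(τ)‖₂ dτ`.

Also recorded: `hasDerivAt_tri_of_cos_ne_zero`, `abs_deriv_tri_le_one`, `hasDerivAt_gaussKernel`,
`continuous_gaussKernel`, `integral_abs_mul_gaussKernel` (`∫|u| g_δ(u) du = 2δ/√(2π)`),
`hasDerivAt_roundedSaw`, `deriv_roundedSaw_eq`, `hasDerivAt_deriv_roundedSaw`,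
`integral_Ioi_mul_exp_neg_mul_sq` (`∫₀^∞ x e^{−bx²} dx = 1/(2b)`, real form of Mathlib's complex lemma).

## Mathlib / tree search

Mathlib: `hasDerivAt_integral_of_dominated_loc_of_lip`, `hasDerivAt_integral_of_dominated_loc_of_deriv_le`
(`Analysis.Calculus.ParametricIntegral`), `integral_sub_left_eq_self`, `integral_comp_abs`,
`integral_mul_cexp_neg_mul_sq`, `integral_gaussian`, `integrable_exp_neg_mul_sq`,
`integrable_mul_exp_neg_mul_sq`, `Real.hasDerivAt_arcsin`, `Real.cos_eq_zero_iff`,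
`Set.Countable.ae_notMem`, `norm_deriv_le_of_lipschitz`, `measurable_deriv`. Tree: `tri`, `gaussKernel`,
`roundedSaw`, `lipschitzWith_tri`, `abs_tri_le`, `continuous_tri`, `gaussKernel_nonneg`,
`integrable_gaussKernel`, `integral_gaussKernel`, `CascadeParams.U`, `contDiff_U` (`SawtoothCascade*`).
Searched `deriv_roundedSaw|roundedSaw''|hasDerivAt_roundedSaw`: nothing prior (smoothness of `S_δ` was
proved in `SawtoothCascadeSmooth` by the moment-generating-function route, without derivative formulas).

## References

* G. B. Folland, *Real Analysis*, 2nd ed., Wiley 1999, §8.2 Prop. 8.10 and Thm. 2.27. [Folland1999]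
* T. Elgindi, K. Liss, J. Mattingly, arXiv:2304.05374, §1 and Rmk. 1.4 (the piecewise-linear pulsed shears
  and their smoothing). [ElgindiLissMattingly2025]
-/

noncomputable section

open MeasureTheory Set Filter Topology
open scoped NNReal ENNReal

namespace Literature.Analysis.FluidPDE.SawtoothCascade

open Literature.Analysis Literature.Analysis.FunctionSpaces

/-! ### §1 The triangle wave: slope `±1` off the corners -/

/-- `|tri′| ≤ 1` everywhere (`tri` is `1`-Lipschitz; Mathlib's `deriv` is `0` at the corners).
[cite: ElgindiLissMattingly2025, §1 (H_α, V_α have slope ±α)] -/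
theorem abs_deriv_tri_le_one (θ : ℝ) : |deriv tri θ| ≤ 1 := by
  have h := norm_deriv_le_of_lipschitz (x₀ := θ) lipschitzWith_tri
  simpa [Real.norm_eq_abs] using h

/-- Off the corner set `{cos θ = 0} = π/2 + πℤ` the triangle wave `tri = arcsin ∘ sin` is differentiable
(chain rule, `arcsin` being differentiable off `±1`). [cite: ElgindiLissMattingly2025, §1 (H_α, V_α piecewise linear with corners)] -/
theorem hasDerivAt_tri_of_cos_ne_zero {θ : ℝ} (h : Real.cos θ ≠ 0) : HasDerivAt tri (deriv tri θ) θ := by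
  have hs : Real.sin θ ≠ -1 ∧ Real.sin θ ≠ 1 := by
    constructor
    · intro h1; exact h (Real.cos_eq_zero_iff_sin_eq.2 (Or.inr h1))
    · intro h1; exact h (Real.cos_eq_zero_iff_sin_eq.2 (Or.inl h1))
  have hd : HasDerivAt tri (1 / Real.sqrt (1 - Real.sin θ ^ 2) * Real.cos θ) θ := by
    unfold tri
    exact (Real.hasDerivAt_arcsin hs.1 hs.2).comp θ (Real.hasDerivAt_sin θ)
  exact hd.differentiableAt.hasDerivAt

/-- The corner set `{θ | cos θ = 0}` is countable (`= {(2k+1)π/2}`). [folklore] -/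
private theorem countable_cos_eq_zero : {θ : ℝ | Real.cos θ = 0}.Countable := by
  have h : {θ : ℝ | Real.cos θ = 0} ⊆ range (fun k : ℤ => (2 * k + 1) * Real.pi / 2) := by
    intro θ hθ
    obtain ⟨k, hk⟩ := Real.cos_eq_zero_iff.1 hθ
    exact ⟨k, hk.symm⟩
  exact (countable_range _).mono h

/-- For a.e. `y`, `x ↦ tri(x − y)` is differentiable at `x = θ` with derivative `tri′(θ − y)` (the
exceptional `y` form the countable set `θ − π/2 − πℤ`). [cite: Folland1999, §8.2 Prop. 8.10 (differentiating a convolution)] -/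
theorem ae_hasDerivAt_tri_sub (θ : ℝ) :
    ∀ᵐ y : ℝ, HasDerivAt (fun x => tri (x - y)) (deriv tri (θ - y)) θ := by
  have hc : {y : ℝ | Real.cos (θ - y) = 0}.Countable := by
    have h : {y : ℝ | Real.cos (θ - y) = 0} ⊆ (fun c => θ - c) '' {c : ℝ | Real.cos c = 0} := by
      intro y hy
      exact ⟨θ - y, hy, by ring⟩
    exact (countable_cos_eq_zero.image _).mono h
  filter_upwards [hc.ae_notMem volume] with y hy
  have hy' : Real.cos (θ - y) ≠ 0 := hy
  have h := (hasDerivAt_tri_of_cos_ne_zero hy').comp θ ((hasDerivAt_id θ).sub_const y)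
  rw [mul_one] at h
  exact h

/-! ### §2 The Gaussian kernel: continuity, derivative, first absolute moment -/

/-- The Gaussian kernel is continuous. [cite: Folland1999, Prop. 2.53 (the Gaussian)] -/
theorem continuous_gaussKernel (δ : ℝ) : Continuous (gaussKernel δ) := by
  unfold gaussKernel
  fun_prop

/-- **Derivative of the Gaussian kernel**: `g_δ′(u) = −(u/δ²) g_δ(u)`. [cite: Folland1999, Prop. 2.53 (the Gaussian)] -/
theorem hasDerivAt_gaussKernel (δ u : ℝ) :
    HasDerivAt (gaussKernel δ) (-(u / δ ^ 2) * gaussKernel δ u) u := by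
  have h3 := (((hasDerivAt_pow 2 u).div_const (2 * δ ^ 2)).neg.exp).div_const (δ * Real.sqrt (2 * Real.pi))
  refine h3.congr_deriv ?_
  rcases eq_or_ne δ 0 with hδ | hδ
  · subst hδ
    simp [gaussKernel]
  · simp only [gaussKernel, Nat.cast_ofNat, Pi.neg_apply]
    field_simp
    ring

/-- `∫₀^∞ x e^{−bx²} dx = 1/(2b)` (`b > 0`; the real form of Mathlib's `integral_mul_cexp_neg_mul_sq`).
[cite: Folland1999, Prop. 2.53 (Gaussian integrals)] -/
theorem integral_Ioi_mul_exp_neg_mul_sq {b : ℝ} (hb : 0 < b) :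
    ∫ x in Ioi (0 : ℝ), x * Real.exp (-b * x ^ 2) = (2 * b)⁻¹ := by
  have h := integral_mul_cexp_neg_mul_sq (b := (b : ℂ)) (by simpa using hb)
  have h2 : ∫ r in Ioi (0 : ℝ), ((r * Real.exp (-b * r ^ 2) : ℝ) : ℂ) = (2 * (b : ℂ))⁻¹ := by
    rw [← h]
    refine setIntegral_congr_fun measurableSet_Ioi fun r _ => ?_
    simp only [Complex.ofReal_mul, Complex.ofReal_exp, Complex.ofReal_neg, Complex.ofReal_pow]
  rw [integral_complex_ofReal] at h2
  exact_mod_cast h2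

/-- **First absolute moment of the Gaussian kernel**: `∫ |u| g_δ(u) du = 2δ/√(2π)` (`δ > 0`).
[cite: Folland1999, Prop. 2.53 (Gaussian integrals)] -/
theorem integral_abs_mul_gaussKernel {δ : ℝ} (hδ : 0 < δ) :
    ∫ u, |u| * gaussKernel δ u = 2 * δ / Real.sqrt (2 * Real.pi) := by
  have hb : 0 < 1 / (2 * δ ^ 2) := by positivity
  have hc : 0 < δ * Real.sqrt (2 * Real.pi) := by positivity
  set f : ℝ → ℝ := fun v => v * Real.exp (-(1 / (2 * δ ^ 2)) * v ^ 2) / (δ * Real.sqrt (2 * Real.pi)) with hf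
  have hfun : (fun u => |u| * gaussKernel δ u) = fun u => f |u| := by
    funext u
    simp only [hf, gaussKernel, sq_abs]
    ring_nf
  rw [hfun, integral_comp_abs]
  have hI : ∫ x in Ioi (0 : ℝ), f x = (2 * (1 / (2 * δ ^ 2)))⁻¹ / (δ * Real.sqrt (2 * Real.pi)) := by
    simp only [hf]
    rw [integral_div, integral_Ioi_mul_exp_neg_mul_sq hb]
  rw [hI]
  field_simp

/-! ### §3 The first derivative of the rounded sawtooth -/

/-- The integrand of `S_δ(θ) = ∫ tri(θ − y) g_δ(y) dy` is integrable (`δ > 0`). [cite: Folland1999, §8.2 Prop. 8.8 (‖f ∗ g‖_u ≤ ‖f‖_∞‖g‖₁)] -/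
theorem integrable_tri_sub_mul_gaussKernel' {δ : ℝ} (hδ : 0 < δ) (θ : ℝ) :
    Integrable (fun y => tri (θ - y) * gaussKernel δ y) := by
  refine (integrable_gaussKernel hδ).bdd_mul (c := Real.pi / 2) ?_ (ae_of_all _ fun y => ?_)
  · exact (continuous_tri.comp (continuous_const.sub continuous_id)).aestronglyMeasurable
  · rw [Real.norm_eq_abs]
    exact abs_tri_le _

/-- **`S_δ′(θ) = ∫ tri′(θ − y) g_δ(y) dy`**: the Gaussian mollification of the `1`-Lipschitz triangle wave
is differentiable, the derivative falling on the Lipschitz factor (differentiation under the integral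
sign for a Lipschitz integrand, Folland Thm. 2.27; `tri′` exists off a countable set). (`δ > 0`.)
[cite: Folland1999, §8.2 Prop. 8.10 (∂(f ∗ g) = (∂f) ∗ g) with Thm. 2.27] -/
theorem hasDerivAt_roundedSaw {δ : ℝ} (hδ : 0 < δ) (θ : ℝ) :
    HasDerivAt (roundedSaw δ) (∫ y, deriv tri (θ - y) * gaussKernel δ y) θ := by
  have hF_meas : ∀ᶠ x in 𝓝 θ, AEStronglyMeasurable (fun y => tri (x - y) * gaussKernel δ y) volume :=
    Eventually.of_forall fun x => (integrable_tri_sub_mul_gaussKernel' hδ x).aestronglyMeasurable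
  have hF'_meas : AEStronglyMeasurable (fun y => deriv tri (θ - y) * gaussKernel δ y) volume :=
    (((measurable_deriv tri).comp (measurable_const.sub measurable_id)).mul
      (continuous_gaussKernel δ).measurable).aestronglyMeasurable
  have h_lip : ∀ᵐ y : ℝ, LipschitzOnWith (Real.nnabs (gaussKernel δ y))
      (fun x => tri (x - y) * gaussKernel δ y) univ := by
    refine ae_of_all _ fun y => LipschitzOnWith.of_dist_le_mul fun x _ x' _ => ?_
    rw [Real.dist_eq, Real.dist_eq, ← sub_mul, abs_mul, Real.coe_nnabs,
      abs_of_nonneg (gaussKernel_nonneg hδ.le y), mul_comm]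
    refine mul_le_mul_of_nonneg_left ?_ (gaussKernel_nonneg hδ.le y)
    calc |tri (x - y) - tri (x' - y)| ≤ |x - y - (x' - y)| := abs_tri_sub_tri_le _ _
      _ = |x - x'| := by rw [show x - y - (x' - y) = x - x' by ring]
  have h := hasDerivAt_integral_of_dominated_loc_of_lip (μ := volume) (F' := fun y => deriv tri (θ - y) * gaussKernel δ y)
    (bound := gaussKernel δ) univ_mem hF_meas (integrable_tri_sub_mul_gaussKernel' hδ θ) hF'_meas h_lip
    (integrable_gaussKernel hδ) ?_
  · exact h.2
  · filter_upwards [ae_hasDerivAt_tri_sub θ] with y hy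
    exact hy.mul_const _

/-- **`S_δ′(θ) = ∫ tri′(s) g_δ(θ − s) ds`** (the derivative in the symmetric form of the convolution,
`y = θ − s`). [cite: Folland1999, §8.2 Prop. 8.10 (∂(f ∗ g) = (∂f) ∗ g = f ∗ ∂g)] -/
theorem deriv_roundedSaw_eq {δ : ℝ} (hδ : 0 < δ) (θ : ℝ) :
    deriv (roundedSaw δ) θ = ∫ s, deriv tri s * gaussKernel δ (θ - s) := by
  rw [(hasDerivAt_roundedSaw hδ θ).deriv]
  have hsub := integral_sub_left_eq_self (fun s => deriv tri s * gaussKernel δ (θ - s)) volume θ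
  simp only [sub_sub_cancel] at hsub
  exact hsub

/-! ### §4 The second derivative and the curvature bound `|S_δ″| ≤ 2/(δ√(2π))` -/

/-- `u ↦ |u| g_δ(u)` is integrable (`δ > 0`). [cite: Folland1999, Prop. 2.53 (Gaussian integrals)] -/
theorem integrable_abs_mul_gaussKernel {δ : ℝ} (hδ : 0 < δ) : Integrable (fun u => |u| * gaussKernel δ u) := by
  have hb : 0 < 1 / (2 * δ ^ 2) := by positivity
  have h1 : Integrable (fun u : ℝ => |u * Real.exp (-(1 / (2 * δ ^ 2)) * u ^ 2)|) :=
    (integrable_mul_exp_neg_mul_sq hb).abs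
  have h2 := h1.div_const (δ * Real.sqrt (2 * Real.pi))
  refine h2.congr (ae_of_all _ fun u => ?_)
  simp only [gaussKernel, abs_mul, abs_of_pos (Real.exp_pos _)]
  ring_nf

/-- The dominating function `(|u| + 1) e^{−u²/(4δ²)}` is integrable. [folklore] -/
private theorem integrable_majorant {δ : ℝ} (hδ : 0 < δ) :
    Integrable (fun u : ℝ => (|u| + 1) * Real.exp (-(1 / (4 * δ ^ 2)) * u ^ 2)) := by
  have hb : 0 < 1 / (4 * δ ^ 2) := by positivity
  have h1 : Integrable (fun u : ℝ => |u * Real.exp (-(1 / (4 * δ ^ 2)) * u ^ 2)|) :=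
    (integrable_mul_exp_neg_mul_sq hb).abs
  have h2 : Integrable (fun u : ℝ => Real.exp (-(1 / (4 * δ ^ 2)) * u ^ 2)) := integrable_exp_neg_mul_sq hb
  refine (h1.add h2).congr (ae_of_all _ fun u => ?_)
  simp only [abs_mul, abs_of_pos (Real.exp_pos _), Pi.add_apply]
  ring

/-- **`S_δ″(θ) = ∫ tri′(s) g_δ′(θ − s) ds`**: the derivative `S_δ′ = tri′ ⋆ g_δ` is differentiable, the
second derivative falling on the Gaussian (differentiation under the integral sign with the dominating
function `(|s − θ| + 1) e^{−(s−θ)²/4δ²}` on the unit ball around `θ`; `g_δ′(u) = −(u/δ²)g_δ(u)`). (`δ > 0`.)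
[cite: Folland1999, §8.2 Prop. 8.10 (∂(f ∗ g) = f ∗ ∂g) with Thm. 2.27] -/
theorem hasDerivAt_deriv_roundedSaw {δ : ℝ} (hδ : 0 < δ) (θ : ℝ) :
    HasDerivAt (deriv (roundedSaw δ))
      (∫ s, deriv tri s * (-((θ - s) / δ ^ 2) * gaussKernel δ (θ - s))) θ := by
  have hfun : deriv (roundedSaw δ) = fun x => ∫ s, deriv tri s * gaussKernel δ (x - s) :=
    funext fun x => deriv_roundedSaw_eq hδ x
  rw [hfun]
  set C : ℝ := Real.exp (1 / (2 * δ ^ 2)) / (δ ^ 2 * (δ * Real.sqrt (2 * Real.pi))) with hC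
  have hCpos : 0 < C := by positivity
  -- measurability and integrability of the integrand
  have hmeas : ∀ x : ℝ, AEStronglyMeasurable (fun s => deriv tri s * gaussKernel δ (x - s)) volume := fun x =>
    ((measurable_deriv tri).mul ((continuous_gaussKernel δ).measurable.comp (measurable_const.sub measurable_id))).aestronglyMeasurable
  have hF_int : Integrable (fun s => deriv tri s * gaussKernel δ (θ - s)) := by
    refine ((integrable_gaussKernel hδ).comp_sub_left θ).bdd_mul (c := 1) (measurable_deriv tri).aestronglyMeasurable
      (ae_of_all _ fun s => ?_)
    rw [Real.norm_eq_abs]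
    exact abs_deriv_tri_le_one s
  have hF'_meas : AEStronglyMeasurable
      (fun s => deriv tri s * (-((θ - s) / δ ^ 2) * gaussKernel δ (θ - s))) volume :=
    ((measurable_deriv tri).mul (((measurable_const.sub measurable_id).div_const _).neg.mul
      ((continuous_gaussKernel δ).measurable.comp (measurable_const.sub measurable_id)))).aestronglyMeasurable
  -- the domination on the unit ball around `θ`
  have h_bound : ∀ᵐ s : ℝ, ∀ x ∈ Metric.ball θ 1,
      ‖deriv tri s * (-((x - s) / δ ^ 2) * gaussKernel δ (x - s))‖ ≤
        C * ((|s - θ| + 1) * Real.exp (-(1 / (4 * δ ^ 2)) * (s - θ) ^ 2)) := by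
    refine ae_of_all _ fun s x hx => ?_
    rw [Metric.mem_ball, Real.dist_eq] at hx
    have he : (x - θ) ^ 2 ≤ 1 := by
      have h1 := abs_lt.1 hx
      nlinarith
    have hxs : (s - θ) ^ 2 / 2 - 1 ≤ (x - s) ^ 2 := by
      nlinarith [sq_nonneg ((θ - s) + 2 * (x - θ)), he]
    have hxabs : |x - s| ≤ |s - θ| + 1 := by
      calc |x - s| = |(x - θ) + (θ - s)| := by ring_nf
        _ ≤ |x - θ| + |θ - s| := abs_add_le _ _
        _ ≤ 1 + |s - θ| := by rw [abs_sub_comm θ s]; linarith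
        _ = |s - θ| + 1 := by ring
    have hg : gaussKernel δ (x - s) ≤
        Real.exp (1 / (2 * δ ^ 2)) * Real.exp (-(1 / (4 * δ ^ 2)) * (s - θ) ^ 2) / (δ * Real.sqrt (2 * Real.pi)) := by
      unfold gaussKernel
      rw [← Real.exp_add]
      refine div_le_div_of_nonneg_right (Real.exp_le_exp.2 ?_) (by positivity)
      rw [← sub_nonneg]
      have h4 : (0 : ℝ) < 4 * δ ^ 2 := by positivity
      have : 1 / (2 * δ ^ 2) + -(1 / (4 * δ ^ 2)) * (s - θ) ^ 2 - -((x - s) ^ 2 / (2 * δ ^ 2)) =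
          (2 - (s - θ) ^ 2 + 2 * (x - s) ^ 2) / (4 * δ ^ 2) := by
        field_simp
        ring
      rw [this]
      exact div_nonneg (by nlinarith [hxs]) h4.le
    rw [Real.norm_eq_abs, abs_mul, abs_mul, abs_neg, abs_div, abs_of_pos (pow_pos hδ 2),
      abs_of_nonneg (gaussKernel_nonneg hδ.le _)]
    have hg0 : 0 ≤ gaussKernel δ (x - s) := gaussKernel_nonneg hδ.le _
    calc |deriv tri s| * (|x - s| / δ ^ 2 * gaussKernel δ (x - s))
        ≤ 1 * ((|s - θ| + 1) / δ ^ 2 *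
            (Real.exp (1 / (2 * δ ^ 2)) * Real.exp (-(1 / (4 * δ ^ 2)) * (s - θ) ^ 2) /
              (δ * Real.sqrt (2 * Real.pi)))) := by
          refine mul_le_mul (abs_deriv_tri_le_one s) ?_ (by positivity) zero_le_one
          exact mul_le_mul (div_le_div_of_nonneg_right hxabs (pow_pos hδ 2).le) hg hg0 (by positivity)
      _ = C * ((|s - θ| + 1) * Real.exp (-(1 / (4 * δ ^ 2)) * (s - θ) ^ 2)) := by
          rw [hC]
          field_simp
  have hbound_int : Integrable (fun s : ℝ => C * ((|s - θ| + 1) * Real.exp (-(1 / (4 * δ ^ 2)) * (s - θ) ^ 2))) :=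
    ((integrable_majorant hδ).comp_sub_right θ).const_mul C
  -- differentiability of the integrand in the parameter
  have h_diff : ∀ᵐ s : ℝ, ∀ x ∈ Metric.ball θ 1,
      HasDerivAt (fun x => deriv tri s * gaussKernel δ (x - s))
        (deriv tri s * (-((x - s) / δ ^ 2) * gaussKernel δ (x - s))) x := by
    refine ae_of_all _ fun s x _ => ?_
    have h := ((hasDerivAt_gaussKernel δ (x - s)).comp x ((hasDerivAt_id x).sub_const s)).const_mul (deriv tri s)
    rw [mul_one] at h
    exact h
  exact (hasDerivAt_integral_of_dominated_loc_of_deriv_le (μ := volume) (Metric.ball_mem_nhds θ one_pos)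
    (Eventually.of_forall hmeas) hF_int hF'_meas h_bound hbound_int h_diff).2

/-- **The curvature of the rounded sawtooth is at most `2 g_δ(0)`**: `|S_δ″(θ)| ≤ 2/(δ√(2π))` for every
`θ` (`δ > 0`), from `S_δ″ = tri′ ⋆ g_δ′`, `|tri′| ≤ 1` and `∫|g_δ′| = δ⁻² ∫|u| g_δ(u) du = 2/(δ√(2π))`.
[cite: Folland1999, §8.2 Prop. 8.8 (‖f ∗ g‖_u ≤ ‖f‖_∞ ‖g‖₁) and Prop. 8.10] -/
theorem abs_deriv_deriv_roundedSaw_le {δ : ℝ} (hδ : 0 < δ) (θ : ℝ) :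
    |deriv (deriv (roundedSaw δ)) θ| ≤ 2 / (δ * Real.sqrt (2 * Real.pi)) := by
  rw [(hasDerivAt_deriv_roundedSaw hδ θ).deriv]
  have hint : Integrable (fun s => |θ - s| / δ ^ 2 * gaussKernel δ (θ - s)) := by
    have h := ((integrable_abs_mul_gaussKernel hδ).div_const (δ ^ 2)).comp_sub_left θ
    refine h.congr (ae_of_all _ fun s => ?_)
    simp only
    ring
  calc |∫ s, deriv tri s * (-((θ - s) / δ ^ 2) * gaussKernel δ (θ - s))|
      ≤ ∫ s, |θ - s| / δ ^ 2 * gaussKernel δ (θ - s) := by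
        rw [← Real.norm_eq_abs]
        refine norm_integral_le_of_norm_le hint (ae_of_all _ fun s => ?_)
        rw [Real.norm_eq_abs, abs_mul, abs_mul, abs_neg, abs_div, abs_of_pos (pow_pos hδ 2),
          abs_of_nonneg (gaussKernel_nonneg hδ.le _)]
        have hg0 : 0 ≤ |θ - s| / δ ^ 2 * gaussKernel δ (θ - s) :=
          mul_nonneg (div_nonneg (abs_nonneg _) (pow_pos hδ 2).le) (gaussKernel_nonneg hδ.le _)
        calc |deriv tri s| * (|θ - s| / δ ^ 2 * gaussKernel δ (θ - s))
            ≤ 1 * (|θ - s| / δ ^ 2 * gaussKernel δ (θ - s)) :=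
              mul_le_mul_of_nonneg_right (abs_deriv_tri_le_one s) hg0
          _ = |θ - s| / δ ^ 2 * gaussKernel δ (θ - s) := one_mul _
    _ = ∫ u, |u| / δ ^ 2 * gaussKernel δ u :=
        integral_sub_left_eq_self (fun u => |u| / δ ^ 2 * gaussKernel δ u) volume θ
    _ = (∫ u, |u| * gaussKernel δ u) / δ ^ 2 := by
        rw [← integral_div]
        refine integral_congr_ae (ae_of_all _ fun u => ?_)
        simp only
        ring
    _ = 2 / (δ * Real.sqrt (2 * Real.pi)) := by
        rw [integral_abs_mul_gaussKernel hδ]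
        field_simp

/-! ### §5 The cascade profile: `|U_j″| ≤ 2√(2π) · N_j/δ_j` -/

namespace CascadeParams

variable (P : CascadeParams)

/-- **First derivative of the cascade profile**: `U_j′(y) = S_δ′(2πN_j y)` (`δ j > 0`, `N j ≠ 0`).
[cite: ElgindiLissMattingly2025, §1 (H_α, V_α; here mollified and rescaled)] -/
theorem hasDerivAt_U {j : ℕ} (hδ : 0 < P.δ j) (hN : P.N j ≠ 0) (y : ℝ) :
    HasDerivAt (P.U j) (deriv (roundedSaw (P.δ j)) (2 * Real.pi * P.N j * y)) y := by
  have hc : (2 * Real.pi * (P.N j : ℝ)) ≠ 0 := by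
    have : (0 : ℝ) < P.N j := by exact_mod_cast Nat.pos_of_ne_zero hN
    positivity
  have h1 : HasDerivAt (fun y : ℝ => 2 * Real.pi * P.N j * y) (2 * Real.pi * P.N j) y := by
    simpa using (hasDerivAt_id y).const_mul (2 * Real.pi * (P.N j : ℝ))
  have h2 := ((hasDerivAt_roundedSaw hδ (2 * Real.pi * P.N j * y)).comp y h1).div_const (2 * Real.pi * P.N j)
  have hfun : P.U j = fun y => roundedSaw (P.δ j) (2 * Real.pi * P.N j * y) / (2 * Real.pi * P.N j) := by
    funext y; rfl
  rw [hfun]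
  refine h2.congr_deriv ?_
  rw [(hasDerivAt_roundedSaw hδ _).deriv]
  field_simp

/-- `U_j′ = S_δ′(2πN_j ·)` as functions (`δ j > 0`, `N j ≠ 0`). [cite: ElgindiLissMattingly2025, §1 (H_α, V_α; here mollified and rescaled)] -/
theorem deriv_U_eq {j : ℕ} (hδ : 0 < P.δ j) (hN : P.N j ≠ 0) :
    deriv (P.U j) = fun y => deriv (roundedSaw (P.δ j)) (2 * Real.pi * P.N j * y) :=
  funext fun y => (P.hasDerivAt_U hδ hN y).deriv

/-- **Second derivative of the cascade profile**: `U_j″(y) = 2πN_j · S_δ″(2πN_j y)` (`δ j > 0`, `N j ≠ 0`).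
[cite: ElgindiLissMattingly2025, §1 (H_α, V_α; here mollified and rescaled)] -/
theorem hasDerivAt_deriv_U {j : ℕ} (hδ : 0 < P.δ j) (hN : P.N j ≠ 0) (y : ℝ) :
    HasDerivAt (deriv (P.U j))
      (deriv (deriv (roundedSaw (P.δ j))) (2 * Real.pi * P.N j * y) * (2 * Real.pi * P.N j)) y := by
  rw [P.deriv_U_eq hδ hN]
  have h1 : HasDerivAt (fun y : ℝ => 2 * Real.pi * P.N j * y) (2 * Real.pi * P.N j) y := by
    simpa using (hasDerivAt_id y).const_mul (2 * Real.pi * (P.N j : ℝ))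
  have h2 := (hasDerivAt_deriv_roundedSaw hδ (2 * Real.pi * P.N j * y)).comp y h1
  refine h2.congr_deriv ?_
  rw [(hasDerivAt_deriv_roundedSaw hδ _).deriv]

/-- **Curvature cap of the cascade profile**: `|U_j″(y)| ≤ 2√(2π) · N_j/δ_j` for every `y` (`δ j > 0`):
`U_j″ = 2πN_j S_δ″(2πN_j ·)` and `|S_δ″| ≤ 2/(δ√(2π))`; for `N_j = 0` the profile is constant. This is
the hypothesis `|U_j″| ≤ K` of `SawtoothCascadeResponseVorticity` with `K_j = 2√(2π) N_j/δ_j` — the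
"localisation scale `N_j/δ_j`" of the rounded corners. [cite: ElgindiLissMattingly2025, §1 and Rmk. 1.4 (the smoothed pulse profiles)] -/
theorem abs_deriv_deriv_U_le {j : ℕ} (hδ : 0 < P.δ j) (y : ℝ) :
    |deriv (deriv (P.U j)) y| ≤ 2 * Real.sqrt (2 * Real.pi) * P.N j / P.δ j := by
  rcases eq_or_ne (P.N j) 0 with hN | hN
  · have hfun : P.U j = fun _ => 0 := by
      funext y
      simp [CascadeParams.U, hN]
    rw [hfun]
    simp [hN]
  · rw [(P.hasDerivAt_deriv_U hδ hN y).deriv, abs_mul]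
    have hc : 0 < 2 * Real.pi * (P.N j : ℝ) := by
      have : (0 : ℝ) < P.N j := by exact_mod_cast Nat.pos_of_ne_zero hN
      positivity
    rw [abs_of_pos hc]
    have hsq : Real.sqrt (2 * Real.pi) * Real.sqrt (2 * Real.pi) = 2 * Real.pi :=
      Real.mul_self_sqrt (by positivity)
    have hs0 : 0 < Real.sqrt (2 * Real.pi) := by positivity
    calc |deriv (deriv (roundedSaw (P.δ j))) (2 * Real.pi * P.N j * y)| * (2 * Real.pi * P.N j)
        ≤ 2 / (P.δ j * Real.sqrt (2 * Real.pi)) * (2 * Real.pi * P.N j) :=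
          mul_le_mul_of_nonneg_right (abs_deriv_deriv_roundedSaw_le hδ _) hc.le
      _ = 2 * Real.sqrt (2 * Real.pi) * P.N j / P.δ j := by
          field_simp
          nlinarith [hsq]

/-! ### §6 The response-vorticity bounds with the explicit curvature cap -/

variable {P}

/-- **Response vorticity on an H half-slot, explicit cap**: for `0 < δ₀`, `0 < d`, `γ ≥ 0`, `ν ≥ 0`, a
window `[a, b]` inside the H half-slot of phase `j`, and every classical divergence-free solution `(w, q)`
of `∂ₜw + (ū·∇)w + (w·∇)ū = νΔw − ∇q` there with `|ω_w(a, ·)| ≤ M` and `|w₂(τ, ·)| ≤ M₂(τ)`: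
`|ω_w(t, x)| ≤ M + 2√(2π)(N_j/δ_j) ∫ₐᵗ rateH j τ · M₂(τ) dτ`. [cite: Evans2010, §7.1.4 Thm. 8–9 (weak maximum principle with source)] -/
theorem abs_responseVorticity_le_of_mem_H₁ (hδ₀ : 0 < P.δ₀) (hd : 0 < P.d) (hγ : 0 ≤ P.γ) {j : ℕ} {a b : ℝ}
    (hab : a < b) (hI : Icc a b ⊆ Icc (tStart j) (tStart j + tHalf j)) {ν : ℝ} (hν : 0 ≤ ν)
    {w : ℝ → UnitAddTorus (Fin 2) → EuclideanSpace ℝ (Fin 2)} {q : ℝ → UnitAddTorus (Fin 2) → ℝ}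
    (hw : Torus.IsSmoothSpaceTimeOn (Icc a b) w) (hq : Torus.IsSmoothSpaceTimeOn (Icc a b) q)
    (hwdiv : ∀ t ∈ Icc a b, Torus.IsDivFree (w t))
    (hlin : ∀ t ∈ Icc a b, ∀ x, Torus.timeDerivWithin (Icc a b) w t x + Torus.convect (P.field t) (w t) x +
      Torus.convect (w t) (P.field t) x = ν • Torus.laplacian (w t) x - Torus.gradient (q t) x)
    {M : ℝ} (hM : ∀ x, |torusVorticityTensor (w a) 0 1 x| ≤ M)
    {M₂ : ℝ → ℝ} (hM₂c : ContinuousOn M₂ (Icc a b)) (hM₂ : ∀ τ ∈ Icc a b, ∀ y, |w τ y 1| ≤ M₂ τ)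
    {t : ℝ} (ht : t ∈ Icc a b) (x : UnitAddTorus (Fin 2)) :
    |torusVorticityTensor (w t) 0 1 x| ≤
      M + 2 * Real.sqrt (2 * Real.pi) * P.N j / P.δ j * ∫ τ in a..t, P.rateH j τ * M₂ τ :=
  abs_responseVorticity_le_of_mem_H₀ hδ₀ hd hγ hab hI hν hw hq hwdiv hlin hM
    (fun s => P.abs_deriv_deriv_U_le (P.δ_pos hδ₀ hd j) s) hM₂c hM₂ ht x

/-- **Response vorticity on a V half-slot, explicit cap**:
`|ω_w(t, x)| ≤ M + 2√(2π)(N_j/δ_j) ∫ₐᵗ rateV j τ · M₁(τ) dτ` with `|w₁(τ, ·)| ≤ M₁(τ)`. [cite: Evans2010, §7.1.4 Thm. 8–9 (weak maximum principle with source)] -/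
theorem abs_responseVorticity_le_of_mem_V₁ (hδ₀ : 0 < P.δ₀) (hd : 0 < P.d) (hγ : 0 ≤ P.γ) {j : ℕ} {a b : ℝ}
    (hab : a < b) (hI : Icc a b ⊆ Icc (tStart j + tHalf j) (tStart (j + 1))) {ν : ℝ} (hν : 0 ≤ ν)
    {w : ℝ → UnitAddTorus (Fin 2) → EuclideanSpace ℝ (Fin 2)} {q : ℝ → UnitAddTorus (Fin 2) → ℝ}
    (hw : Torus.IsSmoothSpaceTimeOn (Icc a b) w) (hq : Torus.IsSmoothSpaceTimeOn (Icc a b) q)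
    (hwdiv : ∀ t ∈ Icc a b, Torus.IsDivFree (w t))
    (hlin : ∀ t ∈ Icc a b, ∀ x, Torus.timeDerivWithin (Icc a b) w t x + Torus.convect (P.field t) (w t) x +
      Torus.convect (w t) (P.field t) x = ν • Torus.laplacian (w t) x - Torus.gradient (q t) x)
    {M : ℝ} (hM : ∀ x, |torusVorticityTensor (w a) 0 1 x| ≤ M)
    {M₁ : ℝ → ℝ} (hM₁c : ContinuousOn M₁ (Icc a b)) (hM₁ : ∀ τ ∈ Icc a b, ∀ y, |w τ y 0| ≤ M₁ τ)
    {t : ℝ} (ht : t ∈ Icc a b) (x : UnitAddTorus (Fin 2)) :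
    |torusVorticityTensor (w t) 0 1 x| ≤
      M + 2 * Real.sqrt (2 * Real.pi) * P.N j / P.δ j * ∫ τ in a..t, P.rateV j τ * M₁ τ :=
  abs_responseVorticity_le_of_mem_V₀ hδ₀ hd hγ hab hI hν hw hq hwdiv hlin hM
    (fun s => P.abs_deriv_deriv_U_le (P.δ_pos hδ₀ hd j) s) hM₁c hM₁ ht x

/-- **Response enstrophy on an H half-slot, explicit cap**:
`‖ω_w(t)‖₂ ≤ ‖ω_w(a)‖₂ + 2√(2π)(N_j/δ_j) ∫ₐᵗ rateH j τ · ‖w(τ)‖₂ dτ`. [cite: DiPernaLions1989Invent, §II.3] -/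
theorem sqrt_integral_responseVorticity_sq_le_of_mem_H₁ (hδ₀ : 0 < P.δ₀) (hd : 0 < P.d) (hγ : 0 ≤ P.γ)
    {j : ℕ} {a b : ℝ} (hab : a < b) (hI : Icc a b ⊆ Icc (tStart j) (tStart j + tHalf j)) {ν : ℝ} (hν : 0 ≤ ν)
    {w : ℝ → UnitAddTorus (Fin 2) → EuclideanSpace ℝ (Fin 2)} {q : ℝ → UnitAddTorus (Fin 2) → ℝ}
    (hw : Torus.IsSmoothSpaceTimeOn (Icc a b) w) (hq : Torus.IsSmoothSpaceTimeOn (Icc a b) q)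
    (hwdiv : ∀ t ∈ Icc a b, Torus.IsDivFree (w t))
    (hlin : ∀ t ∈ Icc a b, ∀ x, Torus.timeDerivWithin (Icc a b) w t x + Torus.convect (P.field t) (w t) x +
      Torus.convect (w t) (P.field t) x = ν • Torus.laplacian (w t) x - Torus.gradient (q t) x)
    {t : ℝ} (ht : t ∈ Icc a b) :
    Real.sqrt (∫ x, torusVorticityTensor (w t) 0 1 x ^ 2) ≤
      Real.sqrt (∫ x, torusVorticityTensor (w a) 0 1 x ^ 2) +
        2 * Real.sqrt (2 * Real.pi) * P.N j / P.δ j *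
          ∫ τ in a..t, P.rateH j τ * Real.sqrt (∫ x, ‖w τ x‖ ^ 2) :=
  sqrt_integral_responseVorticity_sq_le_of_mem_H₀ hδ₀ hd hγ hab hI hν hw hq hwdiv hlin
    (fun s => P.abs_deriv_deriv_U_le (P.δ_pos hδ₀ hd j) s) ht

/-- **Response enstrophy on a V half-slot, explicit cap**:
`‖ω_w(t)‖₂ ≤ ‖ω_w(a)‖₂ + 2√(2π)(N_j/δ_j) ∫ₐᵗ rateV j τ · ‖w(τ)‖₂ dτ`. [cite: DiPernaLions1989Invent, §II.3] -/
theorem sqrt_integral_responseVorticity_sq_le_of_mem_V₁ (hδ₀ : 0 < P.δ₀) (hd : 0 < P.d) (hγ : 0 ≤ P.γ)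
    {j : ℕ} {a b : ℝ} (hab : a < b) (hI : Icc a b ⊆ Icc (tStart j + tHalf j) (tStart (j + 1))) {ν : ℝ}
    (hν : 0 ≤ ν)
    {w : ℝ → UnitAddTorus (Fin 2) → EuclideanSpace ℝ (Fin 2)} {q : ℝ → UnitAddTorus (Fin 2) → ℝ}
    (hw : Torus.IsSmoothSpaceTimeOn (Icc a b) w) (hq : Torus.IsSmoothSpaceTimeOn (Icc a b) q)
    (hwdiv : ∀ t ∈ Icc a b, Torus.IsDivFree (w t))
    (hlin : ∀ t ∈ Icc a b, ∀ x, Torus.timeDerivWithin (Icc a b) w t x + Torus.convect (P.field t) (w t) x +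
      Torus.convect (w t) (P.field t) x = ν • Torus.laplacian (w t) x - Torus.gradient (q t) x)
    {t : ℝ} (ht : t ∈ Icc a b) :
    Real.sqrt (∫ x, torusVorticityTensor (w t) 0 1 x ^ 2) ≤
      Real.sqrt (∫ x, torusVorticityTensor (w a) 0 1 x ^ 2) +
        2 * Real.sqrt (2 * Real.pi) * P.N j / P.δ j *
          ∫ τ in a..t, P.rateV j τ * Real.sqrt (∫ x, ‖w τ x‖ ^ 2) :=
  sqrt_integral_responseVorticity_sq_le_of_mem_V₀ hδ₀ hd hγ hab hI hν hw hq hwdiv hlin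
    (fun s => P.abs_deriv_deriv_U_le (P.δ_pos hδ₀ hd j) s) ht

end CascadeParams

end Literature.Analysis.FluidPDE.SawtoothCascade

end
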